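import Mathlib.NumberTheory.GaussSum
import Mathlib.NumberTheory.LegendreSymbol.QuadraticChar.Basic
import Mathlib.NumberTheory.Cyclotomic.PrimitiveRoots
import Summits.BirchSwinnertonDyer.Rank1Residual.Additive.PotGoodOrdinary
import Literature.NumberTheory.EllipticCurves.LocalH1TateDualityLangTateProofs
import Literature.NumberTheory.EllipticCurves.QuadraticTwistPadicReduction
import Literature.NumberTheory.EllipticCurves.LFunctionPrimeCoeff
import Literature.NumberTheory.EllipticCurves.BSDConductorProofs
import Literature.NumberTheory.DiophantineGeometry.LocalReductionProofs
import HarnessLib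

/-!
# Additive classes X3/X4, semistability defect 2: a good quadratic twist by `p*` gives Delbourgo's type (G)

HONEST FRAMING (cell `b2b-bsdres`, run/shared/lean/b2b/bsd-rank1-residual/, verbatim in every
file): the goal of the cell is to DELETE the COMBINATION-SHAPED residual classes of the
Birch–Swinnerton-Dyer formula for ALL analytic-rank `≤ 1` elliptic curves over `ℚ` — "full BSD
formula for every rank `≤ 1` curve in class `C`" assembled STRICTLY from published theorems — so
that the rank-`≤ 1` remainder becomes exactly the CONSTRUCTION-SHAPED classes, which are TYPED
(missing-input `Prop`s), NOT attempted. This is not "finishing BSD". Sub-cell `additive-p2`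
(X3/X4, potentially good ordinary half): research route; no claim beyond the stated classes.

Theorems only (no definition, no named fact). The kernel BRIDGE from the census's data bit for the
semistability-defect-2 case (Kodaira `I₀*` at an odd additive `p`: "the quadratic twist
`E^{(p*)}`, `p* = (−1)^{(p−1)/2} p`, has good reduction at `p`") to Delbourgo's hypothesis (G) as
transcribed in `Additive/PotGoodOrdinary.lean` (`TypeG W p`: good reduction of `E_F` above `p` for a
subfield `F` of a `p`-th cyclotomic field):

* `exists_sq_eq_pStar` — in any `p`-th cyclotomic field `L ⊇ ℚ` (`p` odd) there is `g` with
  `g² = p* = (−1)^{⌊p/2⌋} p`: the quadratic Gauss sum (Mathlib `gaussSum_sq` for the quadratic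
  character of `𝔽_p` composed into `L` and the additive character `a ↦ ζ_p^a`,
  `quadraticChar_neg_one`, `ZMod.χ₄_eq_neg_one_pow`). Ireland–Rosen, Prop. 6.3.2.
* `typeG_of_hasGoodReductionAtPrime_quadraticTwist` — if `E^{(p*)}` has good reduction at `p`
  then `TypeG W p`, with witness `F = ℚ(g) = ℚ(√p*) ⊆ ℚ(ζ_p)`: over `F` the twist parameter is a
  square, so `E_F ≅ (E^{(p*)})_F` (tree `exists_variableChange_quadraticTwist_mul_sq`,
  `exists_variableChange_quadraticTwist_one`, `map_quadraticTwist`), good reduction of `E^{(p*)}`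
  at `p` passes to `(E^{(p*)})_F` at every `w ∣ p`
  (`hasGoodReductionAt_baseChange_of_hasGoodReductionAt`, Silverman VII.5.4(a)) and is an
  isomorphism invariant (`hasGoodReductionAt_smul_iff_holds`).

So for the 681 census pairs of type `I₀*` in X3♯(G-ord) ∪ X4♯(G-ord) (N < 2·10⁴; all 421 sub-class
pairs at `p = 3`), the data bit implies (G) in the kernel; the ordinary refinement (`TypeGOrd`:
unit root above `p`, i.e. `p ∤ a_p(E^{(p*)})`) is not transported here.

References: K. Ireland, M. Rosen, *A Classical Introduction to Modern Number Theory*, Prop. 6.3.2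
(`g² = (−1)^{(p−1)/2} p`); D. Delbourgo, Compositio Math. 113 (1998) §1.5 (G); J. H. Silverman,
AEC VII.5.4, X.2 Prop. 2.4.
-/

noncomputable section

open scoped Classical NumberField

open WeierstrassCurve IsDedekindDomain IsDedekindDomain.HeightOneSpectrum NumberField
  Rat.HeightOneSpectrum Literature.NumberTheory.EllipticCurves
  Literature.NumberTheory.EllipticCurves.Rank1Residual

namespace Summit.BirchSwinnertonDyer.Rank1Residual.Additive

/-! ### The quadratic Gauss sum: `√p* ∈ ℚ(ζ_p)` -/

section GaussSum

variable (p : ℕ) [hp : Fact p.Prime] (L : Type) [Field L] [NumberField L]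
  [IsCyclotomicExtension {p} ℚ L]

/-- **`p* = (−1)^{(p−1)/2} p` is a square in the `p`-th cyclotomic field** (`p` odd): the Gauss sum
`g = Σ_a (a/p) ζ_p^a` satisfies `g² = (−1/p)·p = (−1)^{⌊p/2⌋} p` (Ireland–Rosen Prop. 6.3.2; Mathlib
`gaussSum_sq`, `quadraticChar_neg_one`, `ZMod.χ₄_eq_neg_one_pow`; `⌊p/2⌋ = (p−1)/2` for odd `p`). -/
theorem exists_sq_eq_pStar (hp2 : p ≠ 2) : ∃ g : L, g ^ 2 = (-1 : L) ^ (p / 2) * p := by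
  haveI : NeZero p := ⟨hp.out.ne_zero⟩
  have hζ := IsCyclotomicExtension.zeta_spec p ℚ L
  set ψ : AddChar (ZMod p) L := AddChar.zmodChar p hζ.pow_eq_one with hψdef
  have hψ : ψ.IsPrimitive := AddChar.zmodChar_primitive_of_primitive_root p hζ
  set χ : MulChar (ZMod p) L := (quadraticChar (ZMod p)).ringHomComp (Int.castRingHom L)
    with hχdef
  have hchar : ringChar (ZMod p) ≠ 2 := by rw [ZMod.ringChar_zmod_n]; exact hp2
  have hχ1 : χ ≠ 1 :=
    (MulChar.ringHomComp_ne_one_iff (RingHom.injective_int _)).mpr (quadraticChar_ne_one hchar)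
  have hχ2 : χ.IsQuadratic := (quadraticChar_isQuadratic (ZMod p)).comp _
  refine ⟨gaussSum χ ψ, ?_⟩
  rw [gaussSum_sq hχ1 hχ2 hψ, ZMod.card p]
  have hodd : p % 2 = 1 := Nat.odd_iff.mp (hp.out.odd_of_ne_two hp2)
  have hneg : χ (-1) = ((-1 : ℤ) ^ (p / 2) : ℤ) := by
    rw [hχdef, MulChar.ringHomComp_apply, quadraticChar_neg_one hchar, ZMod.card p,
      ZMod.χ₄_eq_neg_one_pow hodd]
    simp
  rw [hneg]
  push_cast
  ring

end GaussSum

/-! ### From a good twist by `p*` to type (G) -/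

section Twist

variable (W : WeierstrassCurve ℚ) (p : ℕ) [hp : Fact p.Prime]

/-- The place-indexed form of good reduction at `p` over `ℚ`: `HasGoodReductionAtPrime p` (the
`ℤ_[p]`-minimal model) implies `HasGoodReductionAt` at the place of `𝓞 ℚ` over `p` (tree bridge
`hasGoodReductionAtPrime_iff_hasGoodReductionAt_ringOfIntegers`). -/
theorem hasGoodReductionAt_of_hasGoodReductionAtPrime (V : WeierstrassCurve ℚ)
    (h : V.HasGoodReductionAtPrime p) :
    V.HasGoodReductionAt ((primesEquiv (R := 𝓞 ℚ)).symm ⟨p, hp.out⟩) := by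
  set v : HeightOneSpectrum (𝓞 ℚ) := (primesEquiv (R := 𝓞 ℚ)).symm ⟨p, hp.out⟩ with hvdef
  have hv : (primesEquiv v : ℕ) = p := by simp [hvdef]
  have key := hasGoodReductionAtPrime_iff_hasGoodReductionAt_ringOfIntegers v V
  revert key h
  generalize primesEquiv v = q at hv ⊢
  obtain ⟨q, hq⟩ := q
  cases hv
  intro h key
  exact key.mp h

/-- A prime `w` of `𝓞 F` containing `p` lies over the place of `𝓞 ℚ` over `p`. -/
theorem under_eq_asIdeal_of_natCast_mem {F : Type} [Field F] [NumberField F]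
    (w : HeightOneSpectrum (𝓞 F)) (hw : (p : 𝓞 F) ∈ w.asIdeal) :
    w.asIdeal.under (𝓞 ℚ) = ((primesEquiv (R := 𝓞 ℚ)).symm ⟨p, hp.out⟩).asIdeal := by
  have hmem : (p : 𝓞 ℚ) ∈ w.asIdeal.under (𝓞 ℚ) := by
    rw [Ideal.under_def, Ideal.mem_comap, map_natCast]; exact hw
  have hne : w.asIdeal.under (𝓞 ℚ) ≠ ⊥ := fun h0 ↦ by
    rw [h0, Ideal.mem_bot, Nat.cast_eq_zero] at hmem
    exact hp.out.ne_zero hmem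
  haveI : w.asIdeal.IsPrime := w.isPrime
  set u : HeightOneSpectrum (𝓞 ℚ) := ⟨w.asIdeal.under (𝓞 ℚ), inferInstance, hne⟩ with hu
  have : u = (primesEquiv (R := 𝓞 ℚ)).symm ⟨p, hp.out⟩ :=
    (natCast_mem_asIdeal_iff_eq_primesEquiv_symm u hp.out).mp hmem
  exact congrArg HeightOneSpectrum.asIdeal this

/-- **Good twist by `p*` ⇒ type (G).** If `p` is odd and the quadratic twist `E^{(p*)}`,
`p* = (−1)^{⌊p/2⌋} p`, has good reduction at `p`, then `E` acquires good reduction above `p` over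
the subfield `F = ℚ(√p*)` of the `p`-th cyclotomic field: `TypeG W p` (Delbourgo's (G)). This is
the semistability-defect-2 (Kodaira `I₀*`) case of the census dictionary. -/
theorem typeG_of_hasGoodReductionAtPrime_quadraticTwist (hp2 : p ≠ 2)
    (hgood : (W.quadraticTwist ((-1 : ℚ) ^ (p / 2) * p)).HasGoodReductionAtPrime p) :
    TypeG W p := by
  haveI hcyc : IsCyclotomicExtension {p} ℚ (CyclotomicField p ℚ) := by
    have h : (CyclotomicField.algebra p ℚ : Algebra ℚ (CyclotomicField p ℚ)) =
        DivisionRing.toRatAlgebra :=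
      Subsingleton.elim _ _
    exact h ▸ CyclotomicField.isCyclotomicExtension p ℚ
  obtain ⟨g, hg⟩ := exists_sq_eq_pStar p (CyclotomicField p ℚ) hp2
  set F : IntermediateField ℚ (CyclotomicField p ℚ) := IntermediateField.adjoin ℚ {g} with hFdef
  refine ⟨CyclotomicField p ℚ, inferInstance, inferInstance, hcyc, F, fun w hw ↦ ?_⟩
  -- notation
  set d : ℚ := (-1 : ℚ) ^ (p / 2) * p with hd
  set v : HeightOneSpectrum (𝓞 ℚ) := (primesEquiv (R := 𝓞 ℚ)).symm ⟨p, hp.out⟩ with hvdef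
  -- good reduction of the twist at the place over `p`, then over `F` at `w`
  have h1 : (W.quadraticTwist d).HasGoodReductionAt v :=
    hasGoodReductionAt_of_hasGoodReductionAtPrime p _ hgood
  haveI : w.asIdeal.LiesOver v.asIdeal := ⟨(under_eq_asIdeal_of_natCast_mem p w hw).symm⟩
  have h2 : ((W.quadraticTwist d).baseChange F).HasGoodReductionAt w :=
    hasGoodReductionAt_baseChange_of_hasGoodReductionAt (W.quadraticTwist d) F v w h1
  -- over `F` the twist parameter is the square of `gF = g ∈ F`
  set gF : F := ⟨g, IntermediateField.mem_adjoin_simple_self ℚ g⟩ with hgF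
  have hgF2 : (algebraMap ℚ F) d = 1 * gF ^ 2 := by
    apply (algebraMap F (CyclotomicField p ℚ)).injective
    rw [one_mul, map_pow, ← IsScalarTower.algebraMap_apply]
    change algebraMap ℚ (CyclotomicField p ℚ) d = g ^ 2
    rw [hg, hd, map_mul, map_pow, map_neg, map_one, map_natCast]
  have hgF0 : gF ≠ 0 := by
    intro h0
    have : (algebraMap ℚ F) d = 0 := by rw [hgF2, h0]; simp
    rw [map_eq_zero] at this
    exact (mul_ne_zero (pow_ne_zero _ (by norm_num)) (by exact_mod_cast hp.out.ne_zero)) this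
  have htw : (W.quadraticTwist d).baseChange F = (W.baseChange F).quadraticTwist (1 * gF ^ 2) := by
    rw [← hgF2]
    exact map_quadraticTwist W (algebraMap ℚ F) d
  -- `W_F ≅ W_F^{(1)} ≅ W_F^{(gF²)}` by changes of variables
  haveI : NeZero (2 : F) := ⟨two_ne_zero⟩
  obtain ⟨C₁, hC₁⟩ := exists_variableChange_quadraticTwist_one (W.baseChange F)
  obtain ⟨C₂, hC₂⟩ := exists_variableChange_quadraticTwist_mul_sq (W.baseChange F) 1 gF hgF0
  have hiso : (C₂ * C₁) • W.baseChange F = (W.quadraticTwist d).baseChange F := by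
    rw [mul_smul, hC₁, hC₂, htw]
  rw [← hasGoodReductionAt_smul_iff_holds w (W.baseChange F) (C₂ * C₁), hiso]
  exact h2

end Twist

end Summit.BirchSwinnertonDyer.Rank1Residual.Additive

end
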